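import Mathlib
import Summits.Ventures.PercRepro2.Defs
import Summits.Ventures.PercRepro2.Independence
import Summits.Ventures.PercRepro2.Harris
import Summits.Ventures.PercRepro2.Graph
import Summits.Ventures.PercRepro2.Exploration
import Summits.Ventures.PercRepro2.Events
import Summits.Ventures.PercRepro2.FourFunctions
import Summits.Ventures.PercRepro2.Induced
import Summits.Ventures.PercRepro2.Frontier
import Summits.Ventures.PercRepro2.ObsIndependence
import Summits.Ventures.PercRepro2.BHK
import Summits.Ventures.PercRepro2.BHKEvents
import Summits.Ventures.PercRepro2.OrderPreservation
import Summits.Ventures.PercRepro2.BHKAvoid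
import Summits.Ventures.PercRepro2.SameClusterAvoid
import Summits.Ventures.PercRepro2.CaseOneRegime
import Summits.Ventures.PercRepro2.CaseOnePos
import Summits.Ventures.PercRepro2.CaseOneJ11
import Summits.Ventures.PercRepro2.CaseOneRV
import Summits.Ventures.PercRepro2.CaseOnePendant
import Summits.Ventures.PercRepro2.CaseOnePendantAny
import Summits.Ventures.PercRepro2.CaseOnePendantNec
import Summits.Ventures.PercRepro2.CaseOneDWorld
import Summits.Ventures.PercRepro2.CaseOneDWorldPin
import Summits.Ventures.PercRepro2.HullDefs
import Summits.Ventures.PercRepro2.OneEdge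
import Summits.Ventures.PercRepro2.StarPattern
import Summits.Ventures.PercRepro2.HCov
import Summits.Ventures.PercRepro2.HCovSwap
import Summits.Ventures.PercRepro2.OddsLemma
import Summits.Ventures.PercRepro2.RV
import Summits.Ventures.PercRepro2.RVBridge
import Summits.Ventures.PercRepro2.CaseOneTwoMark
import Summits.Ventures.PercRepro2.CaseOneTwoMarkMass

/-!
# `a₃` adjacent exactly to `o` and `b`: the masses with `a₃ ∈ C₁`, and `D`, `D_o`
(blind cell PercRepro2, p1 g14; S5 §2.1 (K9) (j), proofs/P1-DWORLD.md §4e)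

Continuation of `CaseOneTwoMarkMass.lean` (same notation): `P(Q, A, O₂) = (1 − p_o) p_b ob₁`,
`P(Q, A, B₂) = p_o (1 − p_b) bo₁`, `P(Q, A, B₂, O₂) = 0`, `D = M − p_o oU − p_b bU + p_o p_b oUbU`,
`D_o = (1 − p_o)(oU − p_b oUbU)` with `oU = P₀(Q₀, o ∈ U)`, `bU = P₀(Q₀, b ∈ U)`,
`oUbU = P₀(Q₀, o ∈ U, b ∈ U)`, `U = C₁ ∪ C₂` (`prob_QAO_twoMark`, `prob_QAB_twoMark`,
`prob_QABO_twoMark`, `Dpd_twoMark`, `Dpdo_twoMark`). -/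

namespace Summit.Ventures.PercRepro2

namespace CaseOne

section MassesD
variable {V : Type*} {E : Type*} [Fintype E] [DecidableEq E] {R : Type*} [CommRing R]
variable {ends : E → Sym2 V} {o b a₃ : V} {eo eb : E}

/-- **`P(Q, a₃ ∈ C₁, o ∈ C₂)`** for `a₃ ~ {o, b}`: `= (1 − p_o) p_b ob₁`, `ob₁ = P₀(Q₀, B₁, O₂)`. -/
theorem prob_QAO_twoMark (p : E → R) (h : IsTwoMarkAt ends o b a₃ eo eb) {a₁ a₂ : V} (h1 : a₁ ≠ a₃)
    (h2 : a₂ ≠ a₃) :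
    prob p ((connEvent ends a₁ a₂)ᶜ ∩ connEvent ends a₁ a₃ ∩ connEvent ends a₂ o) =
      (1 - p eo) * p eb *
        prob (Function.update (Function.update p eo 0) eb 0)
          ((connEvent ends a₁ a₂)ᶜ ∩ connEvent ends a₁ b ∩ connEvent ends a₂ o) := by
  have key := prob_twoPin p h.ne
    ((connEvent ends a₁ a₂)ᶜ ∩ connEvent ends a₁ a₃ ∩ connEvent ends a₂ o) ∅ ∅
    ((connEvent ends a₁ a₂)ᶜ ∩ connEvent ends a₁ b ∩ connEvent ends a₂ o) ∅ ?_ ?_ ?_ ?_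
  · rw [key, prob_empty]
    ring
  · intro ω ho hb
    rw [openCC_tt ho hb]
    simp only [Set.mem_compl_iff, Set.mem_inter_iff, mem_connEvent, Set.mem_empty_iff_false,
      iff_false]
    rw [conn_both_iff h ω h1 h2, conn_both_a3_iff h ω h1, conn_both_iff h ω h2 h.ne_o,
      base2_eq_self ho hb, conn_comm_iff ω b a₂, conn_comm_iff ω o a₂]
    have hoo := conn_refl ends ω o
    have t1 : Conn ends ω a₁ o → Conn ends ω a₂ o → Conn ends ω a₁ a₂ :=
      fun x y => conn_trans x (conn_symm y)
    have t2 : Conn ends ω a₁ b → Conn ends ω a₂ b → Conn ends ω a₁ a₂ :=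
      fun x y => conn_trans x (conn_symm y)
    tauto
  · intro ω ho hb
    rw [openCC_tf h.ne ho hb]
    simp only [Set.mem_compl_iff, Set.mem_inter_iff, mem_connEvent, Set.mem_empty_iff_false,
      iff_false]
    rw [conn_open_o_iff h ω h1 h2, conn_open_o_a3_iff h ω h1, conn_open_o_iff h ω h2 h.ne_o,
      base2_eq_self ho hb]
    exact fun hh => hh.1.1 (conn_trans hh.1.2 (conn_symm hh.2))
  · intro ω ho hb
    rw [openCC_ft ho hb]
    simp only [Set.mem_compl_iff, Set.mem_inter_iff, mem_connEvent]
    rw [conn_open_b_iff h ω h1 h2, conn_open_b_a3_iff h ω h1, conn_open_b_iff h ω h2 h.ne_o,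
      base2_eq_self ho hb]
  · intro ω ho hb
    rw [openCC_ff ho hb]
    simp only [Set.mem_compl_iff, Set.mem_inter_iff, mem_connEvent, Set.mem_empty_iff_false,
      iff_false]
    exact fun hh => not_conn_base2 h ω h1 hh.1.2

/-- **`P(Q, a₃ ∈ C₁, b ∈ C₂)`** for `a₃ ~ {o, b}`: `= p_o (1 − p_b) bo₁`, `bo₁ = P₀(Q₀, O₁, B₂)`. -/
theorem prob_QAB_twoMark (p : E → R) (h : IsTwoMarkAt ends o b a₃ eo eb) {a₁ a₂ : V} (h1 : a₁ ≠ a₃)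
    (h2 : a₂ ≠ a₃) :
    prob p ((connEvent ends a₁ a₂)ᶜ ∩ connEvent ends a₁ a₃ ∩ connEvent ends a₂ b) =
      p eo * (1 - p eb) *
        prob (Function.update (Function.update p eo 0) eb 0)
          ((connEvent ends a₁ a₂)ᶜ ∩ connEvent ends a₁ o ∩ connEvent ends a₂ b) := by
  have key := prob_twoPin p h.ne
    ((connEvent ends a₁ a₂)ᶜ ∩ connEvent ends a₁ a₃ ∩ connEvent ends a₂ b) ∅
    ((connEvent ends a₁ a₂)ᶜ ∩ connEvent ends a₁ o ∩ connEvent ends a₂ b) ∅ ∅ ?_ ?_ ?_ ?_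
  · rw [key, prob_empty]
    ring
  · intro ω ho hb
    rw [openCC_tt ho hb]
    simp only [Set.mem_compl_iff, Set.mem_inter_iff, mem_connEvent, Set.mem_empty_iff_false,
      iff_false]
    rw [conn_both_iff h ω h1 h2, conn_both_a3_iff h ω h1, conn_both_iff h ω h2 h.ne_b,
      base2_eq_self ho hb, conn_comm_iff ω b a₂, conn_comm_iff ω o a₂]
    have hbb := conn_refl ends ω b
    have t1 : Conn ends ω a₁ o → Conn ends ω a₂ o → Conn ends ω a₁ a₂ :=
      fun x y => conn_trans x (conn_symm y)
    have t2 : Conn ends ω a₁ b → Conn ends ω a₂ b → Conn ends ω a₁ a₂ :=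
      fun x y => conn_trans x (conn_symm y)
    tauto
  · intro ω ho hb
    rw [openCC_tf h.ne ho hb]
    simp only [Set.mem_compl_iff, Set.mem_inter_iff, mem_connEvent]
    rw [conn_open_o_iff h ω h1 h2, conn_open_o_a3_iff h ω h1, conn_open_o_iff h ω h2 h.ne_b,
      base2_eq_self ho hb]
  · intro ω ho hb
    rw [openCC_ft ho hb]
    simp only [Set.mem_compl_iff, Set.mem_inter_iff, mem_connEvent, Set.mem_empty_iff_false,
      iff_false]
    rw [conn_open_b_iff h ω h1 h2, conn_open_b_a3_iff h ω h1, conn_open_b_iff h ω h2 h.ne_b,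
      base2_eq_self ho hb]
    exact fun hh => hh.1.1 (conn_trans hh.1.2 (conn_symm hh.2))
  · intro ω ho hb
    rw [openCC_ff ho hb]
    simp only [Set.mem_compl_iff, Set.mem_inter_iff, mem_connEvent, Set.mem_empty_iff_false,
      iff_false]
    exact fun hh => not_conn_base2 h ω h1 hh.1.2

/-- **`P(Q, a₃ ∈ C₁, b ∈ C₂, o ∈ C₂) = 0`** for `a₃ ~ {o, b}`. -/
theorem prob_QABO_twoMark (p : E → R) (h : IsTwoMarkAt ends o b a₃ eo eb) {a₁ a₂ : V} (h1 : a₁ ≠ a₃)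
    (h2 : a₂ ≠ a₃) :
    prob p ((connEvent ends a₁ a₂)ᶜ ∩ connEvent ends a₁ a₃ ∩ connEvent ends a₂ b ∩
      connEvent ends a₂ o) = 0 := by
  have key := prob_twoPin p h.ne
    ((connEvent ends a₁ a₂)ᶜ ∩ connEvent ends a₁ a₃ ∩ connEvent ends a₂ b ∩ connEvent ends a₂ o)
    ∅ ∅ ∅ ∅ ?_ ?_ ?_ ?_
  · rw [key, prob_empty]
    ring
  · intro ω ho hb
    rw [openCC_tt ho hb]
    simp only [Set.mem_compl_iff, Set.mem_inter_iff, mem_connEvent, Set.mem_empty_iff_false,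
      iff_false]
    rw [conn_both_iff h ω h1 h2, conn_both_a3_iff h ω h1, conn_both_iff h ω h2 h.ne_b,
      conn_both_iff h ω h2 h.ne_o, base2_eq_self ho hb, conn_comm_iff ω b a₂, conn_comm_iff ω o a₂]
    have hbb := conn_refl ends ω b
    have hoo := conn_refl ends ω o
    have t1 : Conn ends ω a₁ o → Conn ends ω a₂ o → Conn ends ω a₁ a₂ :=
      fun x y => conn_trans x (conn_symm y)
    have t2 : Conn ends ω a₁ b → Conn ends ω a₂ b → Conn ends ω a₁ a₂ :=
      fun x y => conn_trans x (conn_symm y)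
    tauto
  · intro ω ho hb
    rw [openCC_tf h.ne ho hb]
    simp only [Set.mem_compl_iff, Set.mem_inter_iff, mem_connEvent, Set.mem_empty_iff_false,
      iff_false]
    rw [conn_open_o_iff h ω h1 h2, conn_open_o_a3_iff h ω h1, conn_open_o_iff h ω h2 h.ne_b,
      conn_open_o_iff h ω h2 h.ne_o, base2_eq_self ho hb]
    exact fun hh => hh.1.1.1 (conn_trans hh.1.1.2 (conn_symm hh.2))
  · intro ω ho hb
    rw [openCC_ft ho hb]
    simp only [Set.mem_compl_iff, Set.mem_inter_iff, mem_connEvent, Set.mem_empty_iff_false,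
      iff_false]
    rw [conn_open_b_iff h ω h1 h2, conn_open_b_a3_iff h ω h1, conn_open_b_iff h ω h2 h.ne_b,
      conn_open_b_iff h ω h2 h.ne_o, base2_eq_self ho hb]
    exact fun hh => hh.1.1.1 (conn_trans hh.1.1.2 (conn_symm hh.1.2))
  · intro ω ho hb
    rw [openCC_ff ho hb]
    simp only [Set.mem_compl_iff, Set.mem_inter_iff, mem_connEvent, Set.mem_empty_iff_false,
      iff_false]
    exact fun hh => not_conn_base2 h ω h1 hh.1.1.2

/-- **`D = P(Q, a₃ ∉ U)`** for `a₃ ~ {o, b}`: `D = M − p_o oU − p_b bU + p_o p_b oUbU` with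
`oU = P₀(Q₀, O₁ ∪ O₂)`, `bU = P₀(Q₀, B₁ ∪ B₂)`, `oUbU = P₀(Q₀, O₁ ∪ O₂, B₁ ∪ B₂)`. -/
theorem Dpd_twoMark (p : E → R) (h : IsTwoMarkAt ends o b a₃ eo eb) {a₁ a₂ : V} (h1 : a₁ ≠ a₃)
    (h2 : a₂ ≠ a₃) :
    Dpd p ends a₁ a₂ a₃ =
      prob (Function.update (Function.update p eo 0) eb 0) (connEvent ends a₁ a₂)ᶜ -
        p eo * prob (Function.update (Function.update p eo 0) eb 0)
          ((connEvent ends a₁ a₂)ᶜ ∩ (connEvent ends a₁ o ∪ connEvent ends a₂ o)) -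
        p eb * prob (Function.update (Function.update p eo 0) eb 0)
          ((connEvent ends a₁ a₂)ᶜ ∩ (connEvent ends a₁ b ∪ connEvent ends a₂ b)) +
        p eo * p eb * prob (Function.update (Function.update p eo 0) eb 0)
          ((connEvent ends a₁ a₂)ᶜ ∩ (connEvent ends a₁ o ∪ connEvent ends a₂ o) ∩
            (connEvent ends a₁ b ∪ connEvent ends a₂ b)) := by
  set p00 := Function.update (Function.update p eo 0) eb 0 with hp00
  unfold Dpd
  have key := prob_twoPin p h.ne
    ((connEvent ends a₁ a₃)ᶜ ∩ (connEvent ends a₂ a₃)ᶜ ∩ (connEvent ends a₁ a₂)ᶜ)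
    ((connEvent ends a₁ a₂)ᶜ ∩ (connEvent ends a₁ o ∪ connEvent ends a₂ o)ᶜ ∩
      (connEvent ends a₁ b ∪ connEvent ends a₂ b)ᶜ)
    ((connEvent ends a₁ a₂)ᶜ ∩ (connEvent ends a₁ o ∪ connEvent ends a₂ o)ᶜ)
    ((connEvent ends a₁ a₂)ᶜ ∩ (connEvent ends a₁ b ∪ connEvent ends a₂ b)ᶜ)
    (connEvent ends a₁ a₂)ᶜ ?_ ?_ ?_ ?_
  · rw [key, ← hp00]
    have s1 := prob_inter_add_prob_inter_compl p00
      ((connEvent ends a₁ a₂)ᶜ ∩ (connEvent ends a₁ o ∪ connEvent ends a₂ o)ᶜ)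
      (connEvent ends a₁ b ∪ connEvent ends a₂ b)
    have s2 := prob_inter_add_prob_inter_compl p00 (connEvent ends a₁ a₂)ᶜ
      (connEvent ends a₁ o ∪ connEvent ends a₂ o)
    have s3 := prob_inter_add_prob_inter_compl p00
      ((connEvent ends a₁ a₂)ᶜ ∩ (connEvent ends a₁ b ∪ connEvent ends a₂ b))
      (connEvent ends a₁ o ∪ connEvent ends a₂ o)
    have s4 := prob_inter_add_prob_inter_compl p00 (connEvent ends a₁ a₂)ᶜ
      (connEvent ends a₁ b ∪ connEvent ends a₂ b)
    have e3 : (connEvent ends a₁ a₂)ᶜ ∩ (connEvent ends a₁ b ∪ connEvent ends a₂ b) ∩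
        (connEvent ends a₁ o ∪ connEvent ends a₂ o) =
        (connEvent ends a₁ a₂)ᶜ ∩ (connEvent ends a₁ o ∪ connEvent ends a₂ o) ∩
          (connEvent ends a₁ b ∪ connEvent ends a₂ b) := Set.inter_right_comm _ _ _
    have e3' : (connEvent ends a₁ a₂)ᶜ ∩ (connEvent ends a₁ b ∪ connEvent ends a₂ b) ∩
        (connEvent ends a₁ o ∪ connEvent ends a₂ o)ᶜ =
        (connEvent ends a₁ a₂)ᶜ ∩ (connEvent ends a₁ o ∪ connEvent ends a₂ o)ᶜ ∩
          (connEvent ends a₁ b ∪ connEvent ends a₂ b) := Set.inter_right_comm _ _ _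
    rw [e3, e3'] at s3
    linear_combination (p eo * p eb) * (s1 - s3) + p eo * s2 + ((1 - p eo) * p eb) * s4
  · intro ω ho hb
    rw [openCC_tt ho hb]
    simp only [Set.mem_compl_iff, Set.mem_inter_iff, Set.mem_union, mem_connEvent]
    rw [conn_both_iff h ω h1 h2, conn_both_a3_iff h ω h1, conn_both_a3_iff h ω h2,
      base2_eq_self ho hb, conn_comm_iff ω b a₂, conn_comm_iff ω o a₂]
    tauto
  · intro ω ho hb
    rw [openCC_tf h.ne ho hb]
    simp only [Set.mem_compl_iff, Set.mem_inter_iff, Set.mem_union, mem_connEvent]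
    rw [conn_open_o_iff h ω h1 h2, conn_open_o_a3_iff h ω h1, conn_open_o_a3_iff h ω h2,
      base2_eq_self ho hb]
    tauto
  · intro ω ho hb
    rw [openCC_ft ho hb]
    simp only [Set.mem_compl_iff, Set.mem_inter_iff, Set.mem_union, mem_connEvent]
    rw [conn_open_b_iff h ω h1 h2, conn_open_b_a3_iff h ω h1, conn_open_b_a3_iff h ω h2,
      base2_eq_self ho hb]
    tauto
  · intro ω ho hb
    rw [openCC_ff ho hb]
    simp only [Set.mem_compl_iff, Set.mem_inter_iff, mem_connEvent]
    have n1 := not_conn_base2 h ω h1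
    have n2 := not_conn_base2 h ω h2
    rw [base2_eq_self ho hb] at n1 n2 ⊢
    tauto

/-- **`D_o = P(Q, a₃ ∉ U, o ∈ U)`** for `a₃ ~ {o, b}`: `D_o = (1 − p_o)(oU − p_b oUbU)`. -/
theorem Dpdo_twoMark (p : E → R) (h : IsTwoMarkAt ends o b a₃ eo eb) {a₁ a₂ : V} (h1 : a₁ ≠ a₃)
    (h2 : a₂ ≠ a₃) :
    Dpdo p ends o a₁ a₂ a₃ =
      (1 - p eo) *
        (prob (Function.update (Function.update p eo 0) eb 0)
            ((connEvent ends a₁ a₂)ᶜ ∩ (connEvent ends a₁ o ∪ connEvent ends a₂ o)) -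
          p eb * prob (Function.update (Function.update p eo 0) eb 0)
            ((connEvent ends a₁ a₂)ᶜ ∩ (connEvent ends a₁ o ∪ connEvent ends a₂ o) ∩
              (connEvent ends a₁ b ∪ connEvent ends a₂ b))) := by
  set p00 := Function.update (Function.update p eo 0) eb 0 with hp00
  unfold Dpdo
  have key := prob_twoPin p h.ne
    ((connEvent ends a₁ o ∪ connEvent ends a₂ o) ∩ (connEvent ends a₁ a₃)ᶜ ∩
      (connEvent ends a₂ a₃)ᶜ ∩ (connEvent ends a₁ a₂)ᶜ)
    ∅ ∅
    ((connEvent ends a₁ a₂)ᶜ ∩ (connEvent ends a₁ o ∪ connEvent ends a₂ o) ∩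
      (connEvent ends a₁ b ∪ connEvent ends a₂ b)ᶜ)
    ((connEvent ends a₁ a₂)ᶜ ∩ (connEvent ends a₁ o ∪ connEvent ends a₂ o)) ?_ ?_ ?_ ?_
  · rw [key, ← hp00, prob_empty]
    have s1 := prob_inter_add_prob_inter_compl p00
      ((connEvent ends a₁ a₂)ᶜ ∩ (connEvent ends a₁ o ∪ connEvent ends a₂ o))
      (connEvent ends a₁ b ∪ connEvent ends a₂ b)
    linear_combination ((1 - p eo) * p eb) * s1
  · intro ω ho hb
    rw [openCC_tt ho hb]
    simp only [Set.mem_compl_iff, Set.mem_inter_iff, Set.mem_union, mem_connEvent,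
      Set.mem_empty_iff_false, iff_false]
    rw [conn_both_iff h ω h1 h2, conn_both_a3_iff h ω h1, conn_both_a3_iff h ω h2,
      conn_both_iff h ω h1 h.ne_o, conn_both_iff h ω h2 h.ne_o, base2_eq_self ho hb,
      conn_comm_iff ω b a₂, conn_comm_iff ω o a₂]
    have hoo := conn_refl ends ω o
    tauto
  · intro ω ho hb
    rw [openCC_tf h.ne ho hb]
    simp only [Set.mem_compl_iff, Set.mem_inter_iff, Set.mem_union, mem_connEvent,
      Set.mem_empty_iff_false, iff_false]
    rw [conn_open_o_iff h ω h1 h2, conn_open_o_a3_iff h ω h1, conn_open_o_a3_iff h ω h2,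
      conn_open_o_iff h ω h1 h.ne_o, conn_open_o_iff h ω h2 h.ne_o, base2_eq_self ho hb]
    tauto
  · intro ω ho hb
    rw [openCC_ft ho hb]
    simp only [Set.mem_compl_iff, Set.mem_inter_iff, Set.mem_union, mem_connEvent]
    rw [conn_open_b_iff h ω h1 h2, conn_open_b_a3_iff h ω h1, conn_open_b_a3_iff h ω h2,
      conn_open_b_iff h ω h1 h.ne_o, conn_open_b_iff h ω h2 h.ne_o, base2_eq_self ho hb]
    tauto
  · intro ω ho hb
    rw [openCC_ff ho hb]
    simp only [Set.mem_compl_iff, Set.mem_inter_iff, Set.mem_union, mem_connEvent]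
    have n1 := not_conn_base2 h ω h1
    have n2 := not_conn_base2 h ω h2
    rw [base2_eq_self ho hb] at n1 n2 ⊢
    tauto

/-- **`iiExpr` for `a₃ ~ {o, b}`** (the Q-world formula of P1-DWORLD §4e): with
`P(Q) = M − p_o p_b (bo₁ + ob₁)`, `P(Q, B₂) = b + p_o p_b (o₂ − ob − bo₁ − ob₁)`,
`P(Q, A) = p_o(1 − p_b) o₁ + (1 − p_o) p_b b₁ + p_o p_b (o₁ + b₁ − o₁b₁ − bo₁ − ob₁)`,
`P(Q, A, O₂) = (1 − p_o) p_b ob₁`, `P(Q, A, B₂) = p_o(1 − p_b) bo₁`, `P(Q, A, B₂, O₂) = 0`: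
`iiExpr = P(Q) · (−D_o · P(Q, A, B₂)) − P(Q, B₂) · (D · P(Q, A, O₂) − D_o · P(Q, A))`. -/
theorem iiExpr_twoMark (p : E → R) (h : IsTwoMarkAt ends o b a₃ eo eb) {a₁ a₂ : V} (h1 : a₁ ≠ a₃)
    (h2 : a₂ ≠ a₃) :
    iiExpr p ends o a₁ a₂ a₃ b =
      (prob (Function.update (Function.update p eo 0) eb 0) (connEvent ends a₁ a₂)ᶜ -
          p eo * p eb *
            (prob (Function.update (Function.update p eo 0) eb 0)
                ((connEvent ends a₁ a₂)ᶜ ∩ connEvent ends a₁ o ∩ connEvent ends a₂ b) +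
              prob (Function.update (Function.update p eo 0) eb 0)
                ((connEvent ends a₁ a₂)ᶜ ∩ connEvent ends a₁ b ∩ connEvent ends a₂ o))) *
        (-(Dpdo p ends o a₁ a₂ a₃) *
          (p eo * (1 - p eb) *
            prob (Function.update (Function.update p eo 0) eb 0)
              ((connEvent ends a₁ a₂)ᶜ ∩ connEvent ends a₁ o ∩ connEvent ends a₂ b))) -
      (prob (Function.update (Function.update p eo 0) eb 0)
            ((connEvent ends a₁ a₂)ᶜ ∩ connEvent ends a₂ b) +
          p eo * p eb *
            (prob (Function.update (Function.update p eo 0) eb 0)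
                ((connEvent ends a₁ a₂)ᶜ ∩ connEvent ends a₂ o) -
              prob (Function.update (Function.update p eo 0) eb 0)
                ((connEvent ends a₁ a₂)ᶜ ∩ connEvent ends a₂ o ∩ connEvent ends a₂ b) -
              prob (Function.update (Function.update p eo 0) eb 0)
                ((connEvent ends a₁ a₂)ᶜ ∩ connEvent ends a₁ o ∩ connEvent ends a₂ b) -
              prob (Function.update (Function.update p eo 0) eb 0)
                ((connEvent ends a₁ a₂)ᶜ ∩ connEvent ends a₁ b ∩ connEvent ends a₂ o))) *
        (Dpd p ends a₁ a₂ a₃ *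
            ((1 - p eo) * p eb *
              prob (Function.update (Function.update p eo 0) eb 0)
                ((connEvent ends a₁ a₂)ᶜ ∩ connEvent ends a₁ b ∩ connEvent ends a₂ o)) -
          Dpdo p ends o a₁ a₂ a₃ *
            (p eo * (1 - p eb) *
                prob (Function.update (Function.update p eo 0) eb 0)
                  ((connEvent ends a₁ a₂)ᶜ ∩ connEvent ends a₁ o) +
              (1 - p eo) * p eb *
                prob (Function.update (Function.update p eo 0) eb 0)
                  ((connEvent ends a₁ a₂)ᶜ ∩ connEvent ends a₁ b) +
              p eo * p eb *
                (prob (Function.update (Function.update p eo 0) eb 0)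
                    ((connEvent ends a₁ a₂)ᶜ ∩ connEvent ends a₁ o) +
                  prob (Function.update (Function.update p eo 0) eb 0)
                    ((connEvent ends a₁ a₂)ᶜ ∩ connEvent ends a₁ b) -
                  prob (Function.update (Function.update p eo 0) eb 0)
                    ((connEvent ends a₁ a₂)ᶜ ∩ connEvent ends a₁ o ∩ connEvent ends a₁ b) -
                  prob (Function.update (Function.update p eo 0) eb 0)
                    ((connEvent ends a₁ a₂)ᶜ ∩ connEvent ends a₁ o ∩ connEvent ends a₂ b) -
                  prob (Function.update (Function.update p eo 0) eb 0)
                    ((connEvent ends a₁ a₂)ᶜ ∩ connEvent ends a₁ b ∩ connEvent ends a₂ o)))) := by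
  rw [iiExpr_eq_probs]
  have e1 : connEvent ends a₂ b ∩ connEvent ends a₁ a₃ ∩ connEvent ends a₂ o ∩
      (connEvent ends a₁ a₂)ᶜ =
      (connEvent ends a₁ a₂)ᶜ ∩ connEvent ends a₁ a₃ ∩ connEvent ends a₂ b ∩ connEvent ends a₂ o := by
    ext ω
    simp only [Set.mem_inter_iff, Set.mem_compl_iff]
    tauto
  have e2 : connEvent ends a₂ b ∩ connEvent ends a₁ a₃ ∩ (connEvent ends a₁ a₂)ᶜ =
      (connEvent ends a₁ a₂)ᶜ ∩ connEvent ends a₁ a₃ ∩ connEvent ends a₂ b := by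
    ext ω
    simp only [Set.mem_inter_iff, Set.mem_compl_iff]
    tauto
  have e3 : connEvent ends a₂ b ∩ (connEvent ends a₁ a₂)ᶜ =
      (connEvent ends a₁ a₂)ᶜ ∩ connEvent ends a₂ b := Set.inter_comm _ _
  have e4 : connEvent ends a₁ a₃ ∩ connEvent ends a₂ o ∩ (connEvent ends a₁ a₂)ᶜ =
      (connEvent ends a₁ a₂)ᶜ ∩ connEvent ends a₁ a₃ ∩ connEvent ends a₂ o := by
    ext ω
    simp only [Set.mem_inter_iff, Set.mem_compl_iff]
    tauto
  have e5 : connEvent ends a₁ a₃ ∩ (connEvent ends a₁ a₂)ᶜ =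
      (connEvent ends a₁ a₂)ᶜ ∩ connEvent ends a₁ a₃ := Set.inter_comm _ _
  rw [prob_congr_set p e1, prob_congr_set p e2, prob_congr_set p e3, prob_congr_set p e4,
    prob_congr_set p e5, prob_QABO_twoMark p h h1 h2, prob_QAB_twoMark p h h1 h2,
    prob_QB_twoMark p h h1 h2, prob_QAO_twoMark p h h1 h2, prob_QA_twoMark p h h1 h2,
    prob_Q_twoMark p h h1 h2]
  ring

end MassesD

end CaseOne

end Summit.Ventures.PercRepro2
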